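import Mathlib
import Literature.AlgebraicGeometry.Resolution.FormalAxisOfNearChain
import Literature.AlgebraicGeometry.Resolution.GRingPrimeExtension
import HarnessLib

/-!
# Descent of a formal `μ`-th power hyperplane modulo `u₁` through the G-ring property

Topic: `Literature/AlgebraicGeometry/Resolution`. Commutative algebra for the EXISTENCE of a
`v`-prepared regular system of parameters at an isolated point of `{ord J ≥ μ}` of an excellent
regular threefold (`VPreparationExistence.lean`; the "limit branch" of Hironaka's vertex preparation in
a NON-complete ring: Cossart–Jannsen–Saito, LNM 2270, Thm. 8.24 treats the complete case; Cossart–Piltant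
2008, §4 p. 11, work implicitly in `R̂`). OURS, a lemma; no printed statement has this form.

Setting: `R` a regular local ring of dimension `3` which is a G-RING (`IsGRing`, Matsumura §32), with
regular system of parameters `(y₀, u₁, u₂)`; a sequence `y : ℕ → R`, `y 0 = y₀`, with corrections
`y (n+1) − y n ∈ (u₁, u₂) ∩ 𝔪^{n+1}` (so `y n → ŷ` in `R̂ = AdicCompletion 𝔪 R`); an ideal `J` with
`J ⊆ ((y n) + 𝔪^{n+1})^μ + (u₁)` for every `n` — the situation produced by an infinite run of
dissolutions `y ↦ y + λ u₂^b` at the vertex `v` of the characteristic polygon — and the non-degeneracy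
(H) `J ⊄ 𝔪^{μ+1} + (u₁)` ("order `μ` survives modulo `u₁`").

PROVED (no definitions, no named facts):

* `exists_span_pow_sup_of_adicLimit` — there is `z ∈ R` with `(z, u₁, u₂) = 𝔪`, `J ⊆ (z^μ) + (u₁)` and
  `z ≡ ε y₀ mod (u₁, u₂) + 𝔪²` for a unit `ε`;
* `exists_span_pow_sup_of_adicLimit'` — the same normalised to `ε = 1`, and `z ≡ y₀ mod 𝔪²` as soon as
  all corrections lie in `𝔪²`.

Proof. In `R̂` (Noetherian, regular of dimension `3`, faithfully flat over `R`, `𝔪̂ = 𝔪R̂`; tree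
`AdicCompletionRegular`, `FormalAxisOfNearChain.adicLimit`) the limit `ŷ` satisfies
`J R̂ ⊆ (ŷ^μ) + (u₁) + 𝔪̂ⁿ` for all `n`, hence `J R̂ ⊆ (ŷ^μ) + (u₁)` (Krull, `le_of_forall_le_sup_pow`),
and `(ŷ, u₁, u₂) = 𝔪̂` (Nakayama). By (H) and faithful flatness some `g ∈ J` is `a ŷ^μ + b u₁` with `a`
a UNIT. Let `𝔔 = (ŷ, u₁)R̂ ∩ R`, a prime (contraction of the prime `(ŷ, u₁)` generated by part of a
regular system of parameters, `RegularSystemOfParameters.isPrime_span_image`); `g, u₁ ∈ 𝔔`, so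
`ŷ^μ ∈ 𝔔R̂`. Since `R` is a G-ring, `𝔔R̂` is RADICAL (`IsGRing.isRadical_map_adicCompletion`,
EGA IV₂ 7.8.3 / Matsumura §32), so `ŷ ∈ 𝔔R̂ ⊆ (ŷ, u₁)R̂`; writing `ŷ` over generators of `𝔔` and using
`ŷ ∉ (u₁)R̂` (minimality of the regular system), some `q ∈ 𝔔` has `ι q = a' ŷ + b' u₁` with `a'` a
unit; after normalising by lifts of the residues of `a', b'` one gets `z ∈ R` with
`ι z = a'' ŷ + b'' u₁`, `a'' ≡ 1`, `b'' ≡ 0 (mod 𝔪̂)`. Then `(z, u₁, u₂)R̂ = 𝔪̂`,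
`((z^μ) + (u₁))R̂ = (ŷ^μ) + (u₁) ⊇ J R̂`, `ι(z − y₀) ∈ (u₁, u₂)R̂ + 𝔪̂²`, and faithful flatness
(`Ideal.comap_map_eq_self_of_faithfullyFlat`) descends the three statements to `R`.

Without the G-ring hypothesis the conclusion fails (over a Nagata-type non-excellent DVR
`A ⊊ k[[x]]`, `φ ∉ A`, `φ^p ∈ A`: `J = ((y^p − φ^p) + u₁(…))` has `J Ŝ = (y − φ)^p Ŝ` modulo `u₁` but
no such `z`). AI-written formalization; weaker than expert review. Resolution of singularities in
dimension `≥ 4` / characteristic `p` is NOT proved here; `CossartPiltant2008_prop44` is NOT discharged by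
this file; no summit statement is proved here.

## Sources

* H. Matsumura, *Commutative Ring Theory* (1986), §32 p. 256 (formal fibres of G-rings), Thm. 8.10
  (Krull), Thm. 7.5 and §8 (faithful flatness of `R → R̂`), Thm. 14.2 (regular systems of parameters).
  [Matsumura1987]
* V. Cossart, U. Jannsen, S. Saito, LNM 2270 (2020), Thm. 8.24 (preparation in the complete case).
  [CossartJannsenSaito2020]
* V. Cossart, O. Piltant, J. Algebra 320 (2008), §4 p. 11 (vertex dissolution). [CossartPiltant2008]
-/

noncomputable section

open IsLocalRing

namespace Literature.AlgebraicGeometry.Resolution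

universe u

/-! ## Ideal bookkeeping -/

section Bookkeeping

variable {A B : Type u} [CommRing A] [CommRing B]

/-- `f (a, b, c) = (f a, f b, f c)` for ideal extension (private bookkeeping). [folklore] -/
private theorem map_span_triple' (f : A →+* B) (a b c : A) :
    (Ideal.span {a, b, c}).map f = Ideal.span {f a, f b, f c} := by
  rw [Ideal.map_span, Set.image_insert_eq, Set.image_insert_eq, Set.image_singleton]

/-- `f (a, b) = (f a, f b)` for ideal extension (private bookkeeping). [folklore] -/
private theorem map_span_pair' (f : A →+* B) (a b : A) :
    (Ideal.span {a, b}).map f = Ideal.span {f a, f b} := by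
  rw [Ideal.map_span, Set.image_insert_eq, Set.image_singleton]

/-- `f (a) = (f a)` for ideal extension (private bookkeeping). [folklore] -/
private theorem map_span_singleton' (f : A →+* B) (a : A) :
    (Ideal.span {a}).map f = Ideal.span {f a} := by
  rw [Ideal.map_span, Set.image_singleton]

/-- `x' = a x + b w ⟹ x'^μ ∈ (x^μ) + (w)` (private bookkeeping). [folklore] -/
private theorem pow_mem_span_pow_sup_of_eq {x x' a b w : A} (h : x' = a * x + b * w) (μ : ℕ) :
    x' ^ μ ∈ Ideal.span {x ^ μ} ⊔ Ideal.span {w} := by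
  have hd : a * x + b * w - a * x ∣ (a * x + b * w) ^ μ - (a * x) ^ μ := sub_dvd_pow_sub_pow _ _ μ
  rw [add_sub_cancel_left] at hd
  obtain ⟨q, hq⟩ := hd
  have : x' ^ μ = a ^ μ * x ^ μ + w * (b * q) := by
    rw [h, ← mul_assoc, mul_comm w b, ← hq, mul_pow]; ring
  rw [this]
  exact Ideal.add_mem _ (Ideal.mem_sup_left (Ideal.mul_mem_left _ _ (Ideal.subset_span rfl)))
    (Ideal.mem_sup_right (Ideal.mul_mem_right _ _ (Ideal.subset_span rfl)))

/-- If `x' = a x + b w` with `a` a unit then `(x'^μ) + (w) = (x^μ) + (w)` (private bookkeeping).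
[folklore] -/
private theorem span_pow_sup_eq_of_eq_unit_mul_add {x x' a b w : A} (ha : IsUnit a)
    (h : x' = a * x + b * w) (μ : ℕ) :
    Ideal.span {x' ^ μ} ⊔ Ideal.span {w} = Ideal.span {x ^ μ} ⊔ Ideal.span {w} := by
  obtain ⟨a, rfl⟩ := ha
  have h' : x = ↑a⁻¹ * x' + (-(↑a⁻¹ * b)) * w := by
    rw [h, mul_add, ← mul_assoc, ← mul_assoc, Units.inv_mul, one_mul]; ring
  apply le_antisymm
  · exact sup_le ((Ideal.span_singleton_le_iff_mem _).mpr (pow_mem_span_pow_sup_of_eq h μ))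
      le_sup_right
  · exact sup_le ((Ideal.span_singleton_le_iff_mem _).mpr (pow_mem_span_pow_sup_of_eq h' μ))
      le_sup_right

/-- If `x' = a x + b w` with `a` a unit then `(x', w, v) = (x, w, v)` (private bookkeeping).
[folklore] -/
private theorem span_triple_eq_of_eq_unit_mul_add {x x' a b w v : A} (ha : IsUnit a)
    (h : x' = a * x + b * w) :
    Ideal.span {x', w, v} = Ideal.span {x, w, v} := by
  obtain ⟨a, rfl⟩ := ha
  have h' : x = ↑a⁻¹ * x' + (-(↑a⁻¹ * b)) * w := by
    rw [h, mul_add, ← mul_assoc, ← mul_assoc, Units.inv_mul, one_mul]; ring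
  have key : ∀ {p p' e f : A}, p' = e * p + f * w →
      Ideal.span {p', w, v} ≤ Ideal.span {p, w, v} := by
    intro p p' e f hp
    rw [Ideal.span_le]
    intro t ht
    simp only [Set.mem_insert_iff, Set.mem_singleton_iff] at ht
    rcases ht with rfl | rfl | rfl
    · rw [hp]
      exact Ideal.add_mem _ (Ideal.mul_mem_left _ _ (Ideal.subset_span (by simp)))
        (Ideal.mul_mem_left _ _ (Ideal.subset_span (by simp)))
    · exact Ideal.subset_span (by simp)
    · exact Ideal.subset_span (by simp)
  exact le_antisymm (key h) (key h')

end Bookkeeping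

/-! ## The descent theorem -/

section Descent

variable {R : Type u} [CommRing R] [IsRegularLocalRing R]

/-- **B1a (OURS). Descent of a formal `μ`-th power hyperplane modulo `u₁` through the G-ring
property.** `R` a regular local G-ring of dimension `3` with regular system `(y₀, u₁, u₂)`;
`y : ℕ → R` with `y 0 = y₀`, `y (n+1) − y n ∈ (u₁, u₂) ∩ 𝔪^{n+1}`; `J` an ideal with
`J ⊆ ((y n) + 𝔪^{n+1})^μ + (u₁)` for every `n` and `J ⊄ 𝔪^{μ+1} + (u₁)`. Then there is `z ∈ R` with
`(z, u₁, u₂) = 𝔪`, `J ⊆ (z^μ) + (u₁)`, and `z ≡ ε y₀ mod (u₁, u₂) + 𝔪²` for some unit `ε`.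
Proof: in `R̂` the limit `ŷ` has `J R̂ ⊆ (ŷ^μ) + (u₁)` (Krull); a `g ∈ J` off `𝔪^{μ+1} + (u₁)` is
`a ŷ^μ + b u₁` with `a` a unit (faithful flatness), so `ŷ^μ ∈ 𝔔R̂` for the prime
`𝔔 = (ŷ, u₁) ∩ R`; `𝔔R̂` is radical (G-ring), hence `ŷ ∈ 𝔔R̂ = (ŷ, u₁)R̂` and some `z ∈ 𝔔` is
`ŷ·unit + u₁·b`; faithful flatness of `R → R̂` descends the two equalities of ideals.
[cite: Matsumura1987, §32 p. 256; Thm. 8.10; Thm. 7.5] -/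
private theorem descent_core (hG : IsGRing R) (hdim : ringKrullDim R = 3)
    (u₁ u₂ : R) (y : ℕ → R) (hgen : Ideal.span {y 0, u₁, u₂} = maximalIdeal R)
    (hyu : ∀ n, y (n + 1) - y n ∈ Ideal.span {u₁, u₂})
    (hym : ∀ n, y (n + 1) - y n ∈ maximalIdeal R ^ (n + 1))
    {J : Ideal R} {μ : ℕ}
    (hJ : ∀ n, J ≤ (Ideal.span {y n} ⊔ maximalIdeal R ^ (n + 1)) ^ μ ⊔ Ideal.span {u₁})
    (hord : ¬ J ≤ maximalIdeal R ^ (μ + 1) ⊔ Ideal.span {u₁}) :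
    ∃ z : R, Ideal.span {z, u₁, u₂} = maximalIdeal R ∧
      J ≤ Ideal.span {z ^ μ} ⊔ Ideal.span {u₁} ∧
      z - y 0 ∈ Ideal.span {u₁, u₂} ⊔ maximalIdeal R ^ 2 ∧
      ((∀ n, y (n + 1) - y n ∈ maximalIdeal R ^ 2) → z - y 0 ∈ maximalIdeal R ^ 2) := by
  classical
  -- `μ = 0` is trivial
  rcases Nat.eq_zero_or_pos μ with hμ0 | hμ
  · refine ⟨y 0, hgen, ?_, ?_, fun _ => ?_⟩
    · rw [hμ0, pow_zero, Ideal.span_singleton_one]; exact le_sup_left.trans' le_top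
    · rw [sub_self]; exact Ideal.zero_mem _
    · rw [sub_self]; exact Ideal.zero_mem _
  set Rh := AdicCompletion (maximalIdeal R) R with hRh
  set ι : R →+* Rh := algebraMap R Rh with hι
  haveI : IsNoetherianRing Rh := isNoetherianRing_adicCompletion_maximalIdeal R
  haveI hreg : IsRegularLocalRing Rh := isRegularLocalRing_adicCompletion R
  haveI : Module.FaithfullyFlat R Rh := Module.FaithfullyFlat.of_flat_of_isLocalHom
  have hloc : IsLocalHom (algebraMap R Rh) := inferInstance
  have hmmap : maximalIdeal Rh = (maximalIdeal R).map ι := AdicCompletion.maximalIdeal_eq_map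
  have hcm : ∀ I : Ideal R, (I.map ι).comap ι = I := fun I =>
    Ideal.comap_map_eq_self_of_faithfullyFlat I
  have hy0m : y 0 ∈ maximalIdeal R := hgen ▸ Ideal.subset_span (by simp)
  have hu₁m : u₁ ∈ maximalIdeal R := hgen ▸ Ideal.subset_span (by simp)
  have hu₂m : u₂ ∈ maximalIdeal R := hgen ▸ Ideal.subset_span (by simp)
  have hιm : ∀ {r : R}, r ∈ maximalIdeal R → ι r ∈ maximalIdeal Rh := fun hr => by
    rw [hmmap]; exact Ideal.mem_map_of_mem _ hr
  -- `𝔪̂ = (y₀, u₁, u₂) R̂`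
  have hmeq : maximalIdeal Rh = Ideal.span {ι (y 0), ι u₁, ι u₂} := by
    have h := congrArg (Ideal.map ι) hgen
    rw [map_span_triple'] at h
    rw [hmmap, ← h]
  -- the `𝔪`-adic limit `ŷ`
  have hy' : ∀ n, y (n + 1) - y n ∈ maximalIdeal R ^ n := fun n =>
    Ideal.pow_le_pow_right (Nat.le_succ n) (hym n)
  set yh : Rh := adicLimit y hy' with hyh
  have hsub : ∀ n, yh - ι (y n) ∈ maximalIdeal Rh ^ n := fun n => adicLimit_sub_of_mem_pow y hy' n
  -- `ŷ − y₀ ∈ (u₁, u₂) + 𝔪̂²`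
  have hdiff : yh - ι (y 0) ∈ Ideal.span {ι u₁, ι u₂} ⊔ maximalIdeal Rh ^ 2 := by
    have h20 : y 2 - y 0 ∈ Ideal.span {u₁, u₂} := by
      have : y 2 - y 0 = (y 2 - y 1) + (y 1 - y 0) := by ring
      rw [this]; exact Ideal.add_mem _ (hyu 1) (hyu 0)
    have : yh - ι (y 0) = (yh - ι (y 2)) + ι (y 2 - y 0) := by rw [map_sub]; ring
    rw [this]
    refine Ideal.add_mem _ (Ideal.mem_sup_right (hsub 2)) (Ideal.mem_sup_left ?_)
    rw [← map_span_pair']; exact Ideal.mem_map_of_mem _ h20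
  have hspan_u : Ideal.span {ι u₁, ι u₂} ≤ maximalIdeal Rh := by
    rw [Ideal.span_le]
    intro t ht
    simp only [Set.mem_insert_iff, Set.mem_singleton_iff] at ht
    rcases ht with rfl | rfl
    · exact hιm hu₁m
    · exact hιm hu₂m
  have hyhm : yh ∈ maximalIdeal Rh := by
    have : yh = (yh - ι (y 0)) + ι (y 0) := by ring
    rw [this]
    exact Ideal.add_mem _ ((sup_le hspan_u (Ideal.pow_le_self two_ne_zero)) hdiff) (hιm hy0m)
  -- `(ŷ, u₁, u₂) = 𝔪̂`
  have hgenh : Ideal.span {yh, ι u₁, ι u₂} = maximalIdeal Rh := by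
    apply le_antisymm
    · rw [Ideal.span_le]
      intro t ht
      simp only [Set.mem_insert_iff, Set.mem_singleton_iff] at ht
      rcases ht with rfl | rfl | rfl
      · exact hyhm
      · exact hιm hu₁m
      · exact hιm hu₂m
    · have hfg : (maximalIdeal Rh).FG := (maximalIdeal Rh).fg_of_isNoetherianRing
      refine Submodule.le_of_le_smul_of_le_jacobson_bot hfg
        (IsLocalRing.maximalIdeal_le_jacobson ⊥) ?_
      have hle : Ideal.span {ι (y 0), ι u₁, ι u₂} ≤
          Ideal.span {yh, ι u₁, ι u₂} ⊔ maximalIdeal Rh ^ 2 := by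
        rw [Ideal.span_le]
        intro t ht
        simp only [Set.mem_insert_iff, Set.mem_singleton_iff] at ht
        rcases ht with rfl | rfl | rfl
        · have : ι (y 0) = yh - (yh - ι (y 0)) := by ring
          rw [this]
          refine Ideal.sub_mem _ (Ideal.mem_sup_left (Ideal.subset_span (by simp))) ?_
          have hsub2 : Ideal.span {ι u₁, ι u₂} ⊔ maximalIdeal Rh ^ 2 ≤
              Ideal.span {yh, ι u₁, ι u₂} ⊔ maximalIdeal Rh ^ 2 :=
            sup_le_sup_right (Ideal.span_mono (Set.subset_insert _ _)) _
          exact hsub2 hdiff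
        · exact Ideal.mem_sup_left (Ideal.subset_span (by simp))
        · exact Ideal.mem_sup_left (Ideal.subset_span (by simp))
      rw [Ideal.smul_eq_mul, ← pow_two]
      exact hmeq.le.trans hle
  -- embedding dimension `3`: minimality of the basis `(ŷ, u₁, u₂)`
  have hdimh : ringKrullDim Rh = 3 := by
    show ringKrullDim (AdicCompletion (maximalIdeal R) R) = 3
    rw [ringKrullDim_adicCompletion, hdim]
  have hfr : (maximalIdeal Rh).spanFinrank = 3 := by
    have h := IsRegularLocalRing.spanFinrank_maximalIdeal (R := Rh)
    rw [hdimh] at h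
    exact_mod_cast h
  set x : Fin 3 → Rh := ![yh, ι u₁, ι u₂] with hx
  have hx0 : x 0 = yh := rfl
  have hx1 : x 1 = ι u₁ := rfl
  have hx2 : x 2 = ι u₂ := rfl
  have hxrange : Set.range x = {yh, ι u₁, ι u₂} := by
    ext t
    simp only [Set.mem_range, Set.mem_insert_iff, Set.mem_singleton_iff]
    constructor
    · rintro ⟨i, rfl⟩
      fin_cases i
      · exact Or.inl hx0
      · exact Or.inr (Or.inl hx1)
      · exact Or.inr (Or.inr hx2)
    · rintro (rfl | rfl | rfl)
      exacts [⟨0, hx0⟩, ⟨1, hx1⟩, ⟨2, hx2⟩]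
  have hxr : Ideal.span (Set.range x) = maximalIdeal Rh := by rw [hxrange, hgenh]
  -- `P̂ = (ŷ, u₁)` is prime and `ŷ ∉ (u₁)`
  set Ph : Ideal Rh := Ideal.span {yh, ι u₁} with hPh
  have hPprime : Ph.IsPrime := by
    have h := isPrime_span_image hfr x hxr ({0, 1} : Finset (Fin 3))
    rwa [Finset.coe_pair, Set.image_pair, hx0, hx1] at h
  have hnot : yh ∉ Ideal.span {ι u₁} := by
    have h := not_mem_span_image_of_not_mem hfr x hxr (S := {1}) (i := 0) (by simp)
    rwa [Set.image_singleton, hx0, hx1] at h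
  -- `J R̂ ⊆ (ŷ^μ) + (u₁)` by Krull
  set Ah : Ideal Rh := Ideal.span {yh ^ μ} ⊔ Ideal.span {ι u₁} with hAh
  have hJA : J.map ι ≤ Ah := by
    refine le_of_forall_le_sup_pow fun n => ?_
    have h1 : J.map ι ≤ ((Ideal.span {ι (y n)} ⊔ maximalIdeal Rh ^ (n + 1)) ^ μ) ⊔
        Ideal.span {ι u₁} := by
      refine (Ideal.map_mono (hJ n)).trans (le_of_eq ?_)
      rw [Ideal.map_sup, Ideal.map_pow, Ideal.map_sup, Ideal.map_pow, map_span_singleton',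
        map_span_singleton', ← hmmap]
    have h2 : Ideal.span {ι (y n)} ⊔ maximalIdeal Rh ^ (n + 1) ≤
        Ideal.span {yh} ⊔ maximalIdeal Rh ^ n := by
      refine sup_le ?_ (le_sup_right.trans' (Ideal.pow_le_pow_right (Nat.le_succ n)))
      rw [Ideal.span_singleton_le_iff_mem]
      have : ι (y n) = yh - (yh - ι (y n)) := by ring
      rw [this]
      exact Ideal.sub_mem _ (Ideal.mem_sup_left (Ideal.subset_span rfl))
        (Ideal.mem_sup_right (hsub n))
    refine h1.trans ?_
    refine (sup_le_sup_right (Ideal.pow_right_mono h2 μ) _).trans ?_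
    refine (sup_le_sup_right (sup_pow_le_pow_sup _ _ μ) _).trans ?_
    rw [Ideal.span_singleton_pow, sup_right_comm]
  -- an element `g ∈ J` off `𝔪^{μ+1} + (u₁)`: `ι g = a ŷ^μ + b u₁` with `a` a unit
  obtain ⟨g, hgJ, hg⟩ := SetLike.not_le_iff_exists.mp hord
  have hgA : ι g ∈ Ah := hJA (Ideal.mem_map_of_mem _ hgJ)
  have hAh' : Ah = Ideal.span {yh ^ μ, ι u₁} := by rw [hAh, Ideal.span_insert]
  rw [hAh'] at hgA
  obtain ⟨a, b, hab⟩ := Ideal.mem_span_pair.mp hgA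
  have ha : IsUnit a := by
    by_contra ha
    have ham : a ∈ maximalIdeal Rh := (mem_maximalIdeal a).mpr ha
    apply hg
    rw [← hcm (maximalIdeal R ^ (μ + 1) ⊔ Ideal.span {u₁}), Ideal.mem_comap, Ideal.map_sup,
      Ideal.map_pow, ← hmmap, map_span_singleton']
    have : ι g = a * yh ^ μ + b * ι u₁ := hab.symm
    rw [this]
    refine Ideal.add_mem _ (Ideal.mem_sup_left ?_)
      (Ideal.mem_sup_right (Ideal.mul_mem_left _ _ (Ideal.subset_span rfl)))
    rw [pow_succ']
    exact Ideal.mul_mem_mul ham (Ideal.pow_mem_pow hyhm μ)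
  -- the prime `𝔔 = (ŷ, u₁) ∩ R` and the G-ring step
  set Q : Ideal R := Ph.comap ι with hQ
  haveI : Ph.IsPrime := hPprime
  haveI hQprime : Q.IsPrime := Ideal.IsPrime.comap ι
  have hgQ : g ∈ Q := by
    rw [hQ, Ideal.mem_comap, ← hab]
    exact Ideal.add_mem _
      (Ideal.mul_mem_left _ _ (Ideal.pow_mem_of_mem Ph (Ideal.subset_span (by simp)) μ hμ))
      (Ideal.mul_mem_left _ _ (Ideal.subset_span (by simp)))
  have hu₁Q : u₁ ∈ Q := by
    rw [hQ, Ideal.mem_comap]; exact Ideal.subset_span (by simp)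
  have hQmap_le : Q.map ι ≤ Ph := Ideal.map_comap_le
  have hyμ : yh ^ μ ∈ Q.map ι := by
    have h1 : a * yh ^ μ ∈ Q.map ι := by
      rw [eq_sub_of_add_eq hab]
      exact Ideal.sub_mem _ (Ideal.mem_map_of_mem _ hgQ)
        (Ideal.mul_mem_left _ _ (Ideal.mem_map_of_mem _ hu₁Q))
    have : yh ^ μ = ↑(ha.unit⁻¹) * (a * yh ^ μ) := by
      rw [← mul_assoc, IsUnit.val_inv_mul, one_mul]
    rw [this]; exact Ideal.mul_mem_left _ _ h1
  have hrad : (Q.map ι).IsRadical := hG.isRadical_map_adicCompletion Q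
  have hyQ : yh ∈ Q.map ι := hrad (Ideal.mem_radical_iff.mpr ⟨μ, hyμ⟩)
  -- some `z ∈ 𝔔` has `ι z = a' ŷ + b' u₁` with `a'` a unit
  set N : Ideal Rh := maximalIdeal Rh * Ideal.span {yh} ⊔ Ideal.span {ι u₁} with hN
  have hexists : ∃ q ∈ Q, ι q ∉ N := by
    by_contra hall
    push Not at hall
    have hle : Q.map ι ≤ N := Ideal.map_le_iff_le_comap.mpr fun q hq => hall q hq
    obtain ⟨m, hm, s, hs, hms⟩ := Submodule.mem_sup.mp (hle hyQ)
    obtain ⟨m', hm', rfl⟩ := Ideal.mem_mul_span_singleton.mp hm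
    obtain ⟨t, rfl⟩ := Ideal.mem_span_singleton'.mp hs
    have hunit : IsUnit (1 - m') :=
      IsLocalRing.isUnit_one_sub_self_of_mem_nonunits m' hm'
    apply hnot
    have h1 : (1 - m') * yh = t * ι u₁ := by linear_combination (-1 : Rh) * hms
    have : yh = ↑(hunit.unit⁻¹) * (t * ι u₁) := by
      rw [← h1, ← mul_assoc, IsUnit.val_inv_mul, one_mul]
    rw [this, ← mul_assoc]
    exact Ideal.mul_mem_left _ _ (Ideal.subset_span rfl)
  obtain ⟨q, hqQ, hqN⟩ := hexists
  have hqP : ι q ∈ Ph := hQmap_le (Ideal.mem_map_of_mem _ hqQ)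
  obtain ⟨a', b', hab'⟩ := Ideal.mem_span_pair.mp hqP
  have ha' : IsUnit a' := by
    by_contra ha'
    apply hqN
    rw [← hab']
    exact Ideal.add_mem _
      (Ideal.mem_sup_left (Ideal.mul_mem_mul ((mem_maximalIdeal a').mpr ha')
        (Ideal.subset_span rfl)))
      (Ideal.mem_sup_right (Ideal.mul_mem_left _ _ (Ideal.subset_span rfl)))
  -- lifts of the residues of `a'` and `b'`: normalise to `a'' ≡ 1`, `b'' ≡ 0 (mod 𝔪̂)`
  have hlift : ∀ w : Rh, ∃ r : R, ι r - w ∈ maximalIdeal Rh := by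
    intro w
    obtain ⟨rbar, hrbar⟩ := (AdicCompletion.residueField_map_bijective R).2
      (IsLocalRing.residue Rh w)
    obtain ⟨r, rfl⟩ := IsLocalRing.residue_surjective rbar
    rw [IsLocalRing.ResidueField.map_residue] at hrbar
    refine ⟨r, (IsLocalRing.residue_eq_zero_iff _).mp ?_⟩
    rw [map_sub, sub_eq_zero]
    exact hrbar
  obtain ⟨e, hea⟩ := hlift a'
  obtain ⟨β, hβb⟩ := hlift b'
  have hιe : IsUnit (ι e) := by
    by_contra h
    have h1 : ι e ∈ maximalIdeal Rh := (mem_maximalIdeal _).mpr h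
    have h2 : a' = ι e - (ι e - a') := by ring
    exact (mem_maximalIdeal _).mp (h2 ▸ Ideal.sub_mem _ h1 hea) ha'
  have he : IsUnit e := IsLocalHom.map_nonunit (f := algebraMap R Rh) e hιe
  set ei : R := ↑(he.unit⁻¹) with hei
  have heei : ι e * ι ei = 1 := by
    rw [hei, ← map_mul, IsUnit.mul_val_inv, map_one]
  -- the normalised element
  set z : R := ei * (q - β * u₁) with hzdef
  set a'' : Rh := ι ei * a' with ha''
  set b'' : Rh := ι ei * (b' - ι β) with hb''
  have hz_eq : ι z = a'' * yh + b'' * ι u₁ := by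
    rw [hzdef, map_mul, map_sub, map_mul, ← hab', ha'', hb'']; ring
  have ha''u : IsUnit a'' := (he.unit⁻¹.isUnit.map ι).mul ha'
  have ha''1 : a'' - 1 ∈ maximalIdeal Rh := by
    have : a'' - 1 = -(ι ei * (ι e - a')) := by
      rw [ha'', mul_sub, ← heei]; ring
    rw [this, Ideal.neg_mem_iff]
    exact Ideal.mul_mem_left _ _ hea
  have hb''m : b'' ∈ maximalIdeal Rh := by
    rw [hb'', ← neg_sub]
    exact Ideal.mul_mem_left _ _ ((Ideal.neg_mem_iff _).mpr hβb)
  -- `ι (z − y₀) = (a'' − 1) ŷ + (ŷ − y₀) + b'' u₁`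
  have hzy : ι (z - y 0) = (a'' - 1) * yh + (yh - ι (y 0)) + b'' * ι u₁ := by
    rw [map_sub, hz_eq]; ring
  have hsq1 : (a'' - 1) * yh ∈ maximalIdeal Rh ^ 2 := by
    rw [pow_two]; exact Ideal.mul_mem_mul ha''1 hyhm
  have hsq2 : b'' * ι u₁ ∈ maximalIdeal Rh ^ 2 := by
    rw [pow_two]; exact Ideal.mul_mem_mul hb''m (hιm hu₁m)
  -- conclusions
  refine ⟨z, ?_, ?_, ?_, fun hym2 => ?_⟩
  · -- `(z, u₁, u₂) = 𝔪`
    have hmapM : (Ideal.span {z, u₁, u₂}).map ι = (maximalIdeal R).map ι := by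
      rw [map_span_triple', span_triple_eq_of_eq_unit_mul_add ha''u hz_eq, hgenh, hmmap]
    rw [← hcm (Ideal.span {z, u₁, u₂}), hmapM, hcm]
  · -- `J ⊆ (z^μ) + (u₁)`
    have hmapK : (Ideal.span {z ^ μ} ⊔ Ideal.span {u₁}).map ι = Ah := by
      rw [Ideal.map_sup, map_span_singleton', map_span_singleton', map_pow,
        span_pow_sup_eq_of_eq_unit_mul_add ha''u hz_eq μ]
    rw [← hcm (Ideal.span {z ^ μ} ⊔ Ideal.span {u₁}), hmapK]
    exact Ideal.map_le_iff_le_comap.mp hJA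
  · -- `z ≡ y₀ mod (u₁, u₂) + 𝔪²`
    rw [← hcm (Ideal.span {u₁, u₂} ⊔ maximalIdeal R ^ 2), Ideal.mem_comap, Ideal.map_sup,
      map_span_pair', Ideal.map_pow, ← hmmap, hzy]
    exact Ideal.add_mem _ (Ideal.add_mem _ (Ideal.mem_sup_right hsq1) hdiff)
      (Ideal.mem_sup_right hsq2)
  · -- `z ≡ y₀ mod 𝔪²` when the corrections lie in `𝔪²`
    have hdiff2 : yh - ι (y 0) ∈ maximalIdeal Rh ^ 2 := by
      have h20 : y 2 - y 0 ∈ maximalIdeal R ^ 2 := by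
        have : y 2 - y 0 = (y 2 - y 1) + (y 1 - y 0) := by ring
        rw [this]; exact Ideal.add_mem _ (hym2 1) (hym2 0)
      have : yh - ι (y 0) = (yh - ι (y 2)) + ι (y 2 - y 0) := by rw [map_sub]; ring
      rw [this]
      refine Ideal.add_mem _ (hsub 2) ?_
      rw [hmmap, ← Ideal.map_pow]
      exact Ideal.mem_map_of_mem _ h20
    rw [← hcm (maximalIdeal R ^ 2), Ideal.mem_comap, Ideal.map_pow, ← hmmap, hzy]
    exact Ideal.add_mem _ (Ideal.add_mem _ hsq1 hdiff2) hsq2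

/-- **B1a (OURS). Descent of a formal `μ`-th power hyperplane modulo `u₁` through the G-ring
property.** `R` a regular local G-ring of dimension `3` with regular system `(y₀, u₁, u₂)`;
`y : ℕ → R` with `y 0 = y₀`, `y (n+1) − y n ∈ (u₁, u₂) ∩ 𝔪^{n+1}`; `J` an ideal with
`J ⊆ ((y n) + 𝔪^{n+1})^μ + (u₁)` for every `n` and `J ⊄ 𝔪^{μ+1} + (u₁)`. Then there is `z ∈ R` with
`(z, u₁, u₂) = 𝔪`, `J ⊆ (z^μ) + (u₁)`, and `z ≡ ε y₀ mod (u₁, u₂) + 𝔪²` for some unit `ε`.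
Proof: in `R̂` the limit `ŷ` has `J R̂ ⊆ (ŷ^μ) + (u₁)` (Krull); a `g ∈ J` off `𝔪^{μ+1} + (u₁)` is
`a ŷ^μ + b u₁` with `a` a unit (faithful flatness), so `ŷ^μ ∈ 𝔔R̂` for the prime
`𝔔 = (ŷ, u₁) ∩ R`; `𝔔R̂` is radical (G-ring), hence `ŷ ∈ 𝔔R̂ = (ŷ, u₁)R̂` and some `z ∈ 𝔔` is
`ŷ·unit + u₁·b`; faithful flatness of `R → R̂` descends the two equalities of ideals.
[cite: Matsumura1987, §32 p. 256; Thm. 8.10; Thm. 7.5] -/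
theorem exists_span_pow_sup_of_adicLimit (hG : IsGRing R) (hdim : ringKrullDim R = 3)
    (u₁ u₂ : R) (y : ℕ → R) (hgen : Ideal.span {y 0, u₁, u₂} = maximalIdeal R)
    (hyu : ∀ n, y (n + 1) - y n ∈ Ideal.span {u₁, u₂})
    (hym : ∀ n, y (n + 1) - y n ∈ maximalIdeal R ^ (n + 1))
    {J : Ideal R} {μ : ℕ}
    (hJ : ∀ n, J ≤ (Ideal.span {y n} ⊔ maximalIdeal R ^ (n + 1)) ^ μ ⊔ Ideal.span {u₁})
    (hord : ¬ J ≤ maximalIdeal R ^ (μ + 1) ⊔ Ideal.span {u₁}) :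
    ∃ z : R, Ideal.span {z, u₁, u₂} = maximalIdeal R ∧
      J ≤ Ideal.span {z ^ μ} ⊔ Ideal.span {u₁} ∧
      ∃ ε : R, IsUnit ε ∧ z - ε * y 0 ∈ Ideal.span {u₁, u₂} ⊔ maximalIdeal R ^ 2 := by
  obtain ⟨z, hz, hJz, hzy, -⟩ := descent_core hG hdim u₁ u₂ y hgen hyu hym hJ hord
  exact ⟨z, hz, hJz, 1, isUnit_one, by rw [one_mul]; exact hzy⟩

/-- **B1a, sharpened form (OURS).** As `exists_span_pow_sup_of_adicLimit`, normalised to `ε = 1`,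
and recording that `z ≡ y₀ mod 𝔪²` as soon as all corrections `y (n+1) − y n` lie in `𝔪²`.
[cite: Matsumura1987, §32 p. 256; Thm. 8.10; Thm. 7.5] -/
theorem exists_span_pow_sup_of_adicLimit' (hG : IsGRing R) (hdim : ringKrullDim R = 3)
    (u₁ u₂ : R) (y : ℕ → R) (hgen : Ideal.span {y 0, u₁, u₂} = maximalIdeal R)
    (hyu : ∀ n, y (n + 1) - y n ∈ Ideal.span {u₁, u₂})
    (hym : ∀ n, y (n + 1) - y n ∈ maximalIdeal R ^ (n + 1))
    {J : Ideal R} {μ : ℕ}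
    (hJ : ∀ n, J ≤ (Ideal.span {y n} ⊔ maximalIdeal R ^ (n + 1)) ^ μ ⊔ Ideal.span {u₁})
    (hord : ¬ J ≤ maximalIdeal R ^ (μ + 1) ⊔ Ideal.span {u₁}) :
    ∃ z : R, Ideal.span {z, u₁, u₂} = maximalIdeal R ∧
      J ≤ Ideal.span {z ^ μ} ⊔ Ideal.span {u₁} ∧
      z - y 0 ∈ Ideal.span {u₁, u₂} ⊔ maximalIdeal R ^ 2 ∧
      ((∀ n, y (n + 1) - y n ∈ maximalIdeal R ^ 2) → z - y 0 ∈ maximalIdeal R ^ 2) :=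
  descent_core hG hdim u₁ u₂ y hgen hyu hym hJ hord

end Descent

end Literature.AlgebraicGeometry.Resolution

end
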